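import Literature.Barriers.PneNP.NegationLimitedGapProofs
import Literature.Barriers.PneNP.MonotoneGapProofs

/-!
# PneNP / PositionalGames — glue `ParityToMpg`: monotone complexity under substitutions

Helpers (`--supports stmt-PneNP-1301`). A *monotone substitution* replaces every variable of a
Boolean function `F` on variables `K` by a constant or by a variable from `I`
(`ρ : K → Bool ⊕ I`, `G x = F (k ↦ x|ρ k)`; Jukna 2012, §1.4 "projections", without negated
literals). Over the basis `{∧₂, ∨₂}` (no constants!) this does not increase circuit complexity as
long as `G` is not constant: substitute into an optimal circuit for `F` and propagate the
constants away (`Literature.Barriers.PneNP.GateList.substElim_wire`). The second theorem packages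
the way this is used by the glue `ParityToMpg`: if `F` is monotone and `G` has positive monotone
complexity (so some `{∧₂, ∨₂}`-circuit computes `G`, whence `G`, and through the substitution `F`,
map `0̄ ↦ 0`, `1̄ ↦ 1`), then `F` has a monotone circuit
(`Literature.Barriers.PneNP.exists_monotone_circuit`) and
`circuitSizeOver monotoneBasis G ≤ circuitSizeOver monotoneBasis F`.
-/

namespace Summit.PneNP.PneNP.Theorems

open Literature.Computability.Complexity Literature.Computability.Complexity.GateList
  Literature.Barriers.PneNP.GateList

/-- **Monotone complexity does not increase under monotone substitutions** (Jukna 2012, §1.4):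
if `G x = F (x|ρ)` substitutes constants and variables for the variables of `F`, some circuit
over `{∧₂, ∨₂}` computes `F`, and `G` is not constant, then
`circuitSizeOver monotoneBasis G ≤ circuitSizeOver monotoneBasis F` (constant elimination in an
optimal circuit for `F`). [folklore] -/
theorem ptm_circuitSizeOver_le_of_subst {I K : Type*} (ρ : K → Bool ⊕ I)
    {F : (K → Bool) → Bool} {G : (I → Bool) → Bool}
    (hFG : ∀ x, F (fun k => Sum.elim (fun b => b) x (ρ k)) = G x)
    (hF : ∃ C : Circuit K, C.IsOver monotoneBasis ∧ C.Computes F)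
    (hG : ∃ x y, G x ≠ G y) :
    circuitSizeOver monotoneBasis G ≤ circuitSizeOver monotoneBasis F := by
  -- an optimal monotone circuit for `F`
  have hne :
      {s | ∃ C : Circuit K, C.IsOver monotoneBasis ∧ C.Computes F ∧ C.size = s}.Nonempty := by
    obtain ⟨C, hB, hC⟩ := hF
    exact ⟨C.size, C, hB, hC, rfl⟩
  obtain ⟨C, hB, hC, hsize⟩ := Nat.sInf_mem hne
  have hB01 : ∀ g ∈ C.gates, g.fn ∈ monotoneBasis01 := fun g hg =>
    monotoneBasis_subset_monotoneBasis01 (hB g hg)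
  -- substitute and propagate the constants
  obtain ⟨ns, hwf', hB', hlen', hτ⟩ := substElim_wire ρ C.gates (wf_gates C) hB01
  obtain ⟨τ, hτ₀⟩ := hτ C.output C.wf_output
  have hev : ∀ x, wireOf (fun k => Sum.elim (fun b => b) x (ρ k))
      (vals C.gates fun k => Sum.elim (fun b => b) x (ρ k)) C.output = G x := fun x => by
    rw [← circuit_eval, hC, hFG]
  rcases τ with b | w
  · -- the output wire became constant: impossible, `G` is not constant
    exfalso
    obtain ⟨x, y, hxy⟩ := hG
    exact hxy (((hev x).symm.trans (hτ₀ x)).trans ((hev y).symm.trans (hτ₀ y)).symm)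
  · obtain ⟨hw, hfw⟩ := hτ₀
    have hD := circuitSizeOver_le_of_computes (B := monotoneBasis) (f := G)
      (toCircuit ns w hwf' hw) hB' (fun x => by rw [circuit_eval]; exact (hfw x).symm.trans (hev x))
    calc circuitSizeOver monotoneBasis G ≤ (toCircuit ns w hwf' hw).size := hD
      _ = ns.length := rfl
      _ ≤ C.gates.length := hlen'
      _ = circuitSizeOver monotoneBasis F := hsize

/-- The form used by the glue: for a monotone `F` and a `G = F ∘ (·|ρ)` of positive monotone
complexity, `circuitSizeOver monotoneBasis G ≤ circuitSizeOver monotoneBasis F`. (Positivity gives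
a `{∧₂, ∨₂}`-circuit for `G`, so `G 0̄ = 0`, `G 1̄ = 1`; by monotonicity through the substitution
the same holds for `F`, which therefore has a `{∧₂, ∨₂}`-circuit.) [folklore] -/
theorem ptm_transfer_step {I K : Type*} [Fintype K] [DecidableEq K] (ρ : K → Bool ⊕ I)
    {F : (K → Bool) → Bool} {G : (I → Bool) → Bool}
    (hFG : ∀ x, F (fun k => Sum.elim (fun b => b) x (ρ k)) = G x)
    (hFmono : Monotone F) (hGpos : 0 < circuitSizeOver monotoneBasis G) :
    circuitSizeOver monotoneBasis G ≤ circuitSizeOver monotoneBasis F := by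
  -- `G` has a monotone circuit, hence maps `b̄ ↦ b`
  obtain ⟨s₀, C₀, hC₀B, hC₀, -⟩ := Nat.nonempty_of_pos_sInf hGpos
  have hGc : ∀ b, G (fun _ => b) = b := fun b =>
    (hC₀ _).symm.trans (C₀.eval_const_of_isOver_monotoneBasis hC₀B b)
  -- so does `F`
  have hF0 : F (fun _ => false) = false := by
    have h := hFmono
      (show (fun _ => false) ≤ fun k => Sum.elim (fun b => b) (fun _ : I => false) (ρ k)
        from fun k => Bool.false_le _)
    rw [hFG, hGc] at h
    revert h
    cases F (fun _ => false) <;> simp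
  have hF1 : F (fun _ => true) = true := by
    have h := hFmono
      (show (fun k => Sum.elim (fun b => b) (fun _ : I => true) (ρ k)) ≤ fun _ => true
        from fun k => Bool.le_true _)
    rw [hFG, hGc] at h
    revert h
    cases F (fun _ => true) <;> simp
  obtain ⟨C, hCB, hC⟩ := Literature.Barriers.PneNP.exists_monotone_circuit F hFmono hF0 hF1
  exact ptm_circuitSizeOver_le_of_subst ρ hFG ⟨C, hCB, hC⟩
    ⟨fun _ => false, fun _ => true, fun h =>
      Bool.false_ne_true ((hGc false).symm.trans (h.trans (hGc true)))⟩

/-- The indicator `x ↦ decide (P x)` of a monotone predicate is monotone. [folklore] -/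
theorem ptm_monotone_decide {α : Type*} [Preorder α] {P : α → Prop} {_ : DecidablePred P}
    (h : ∀ x y, x ≤ y → P x → P y) : Monotone fun x => decide (P x) := by
  intro x y hxy
  dsimp only
  by_cases hx : P x
  · rw [decide_eq_true hx, decide_eq_true (h x y hxy hx)]
  · rw [decide_eq_false hx]
    exact Bool.false_le _

/-- Winning a threshold mean-payoff game, in the route's inlined `∃σ ∀τ` form (owner map `o`,
bit `inl (u,w)` = "edge present" for Even `u` / "edge absent" for Odd `u`, bits `inr (u,j)` =
binary digits of the weight of `u`, threshold "cycle mean `≥ 2^{m-1}`"), is MONOTONE in the input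
bits, whatever the cycle-set function `S`: raising bits adds Even edges, removes Odd edges and
raises weights. [folklore] -/
theorem ptm_mpg_mono {m : ℕ} (o : Fin m → Bool)
    (S : (Fin m → Fin m) → (Fin m → Fin m) → Finset (Fin m))
    {x y : (Fin m × Fin m) ⊕ (Fin m × Fin m) → Bool} (hxy : x ≤ y)
    (hx : ∃ σ : Fin m → Fin m, (∀ u, o u = true → x (Sum.inl (u, σ u)) = true) ∧
      ∀ τ : Fin m → Fin m, (∀ u, o u = false → x (Sum.inl (u, τ u)) = false) →
        2 ^ m * (S σ τ).card ≤ 2 * ∑ u ∈ S σ τ, ∑ j : Fin m,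
          if x (Sum.inr (u, j)) = true then 2 ^ (j : ℕ) else 0) :
    ∃ σ : Fin m → Fin m, (∀ u, o u = true → y (Sum.inl (u, σ u)) = true) ∧
      ∀ τ : Fin m → Fin m, (∀ u, o u = false → y (Sum.inl (u, τ u)) = false) →
        2 ^ m * (S σ τ).card ≤ 2 * ∑ u ∈ S σ τ, ∑ j : Fin m,
          if y (Sum.inr (u, j)) = true then 2 ^ (j : ℕ) else 0 := by
  obtain ⟨σ, hσ, H⟩ := hx
  refine ⟨σ, fun u hu => Bool.le_iff_imp.1 (hxy (Sum.inl (u, σ u))) (hσ u hu), fun τ hτ => ?_⟩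
  have hτx : ∀ u, o u = false → x (Sum.inl (u, τ u)) = false := fun u hu => by
    have h := Bool.le_iff_imp.1 (hxy (Sum.inl (u, τ u)))
    revert h
    rw [hτ u hu]
    cases x (Sum.inl (u, τ u)) <;> simp
  refine (H τ hτx).trans (Nat.mul_le_mul_left 2 (Finset.sum_le_sum fun u _ =>
    Finset.sum_le_sum fun j _ => ?_))
  by_cases hxj : x (Sum.inr (u, j)) = true
  · rw [if_pos hxj, if_pos (Bool.le_iff_imp.1 (hxy (Sum.inr (u, j))) hxj)]
  · rw [if_neg hxj]
    exact Nat.zero_le _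

end Summit.PneNP.PneNP.Theorems
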